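import Literature.NumberTheory.Automorphic.LanglandsTunnellModThree
import Literature.NumberTheory.Automorphic.TunnellOctahedralGlobal
import Literature.NumberTheory.Automorphic.StrongArtinGL2
import Literature.NumberTheory.Automorphic.BCDTModularity
import Literature.NumberTheory.EllipticCurves.Szpiro
import HarnessLib

/-!
# stub-ideation k2 · generation 16 · `stub_modThree` — companion sketch (LOCAL PARITY PIN)

Nothing registered; statements of the helper lemmas of `STUB-IDEAS-stub_modThree-2.md` (g16),
with the two cheap ones PROVED (`surj_of_pinned_unpinned`, `frey_affine_points_mod_three`).
No `sorry`.
-/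

set_option linter.dupNamespace false

namespace Summit.ABC.ABC.Cruxes.FreyModularity.StubModThreeIdeasK2G16

open Literature.NumberTheory Literature.NumberTheory.Automorphic
  Literature.NumberTheory.GaloisRepresentations Literature.NumberTheory.EllipticCurves
open IsDedekindDomain
open scoped NumberField

/-! ## §0 the registered stub and its surjective (octahedral) cell, verbatim from g15 -/

/-- registered stub `stub_modThree` (Lines/Sketch.lean l.143), verbatim. -/
def SigStubModThree : Prop :=
  ∀ (W : WeierstrassCurve ℚ) [W.IsElliptic] (ρ : ModPGaloisRep ℚ (ZMod 3) 2),
    W.IsTorsionGaloisRep 3 ρ → FramedRep.IsAbsolutelyIrreducible ρ → ρ.IsModular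

/-- the surjective cell `SigStubModThreeSurj` of g15 (`stubModThree_of_split` reduces the stub to
this cell and the 2-group cell). -/
def SigStubModThreeSurj : Prop :=
  ∀ (W : WeierstrassCurve ℚ) [W.IsElliptic] (ρ : ModPGaloisRep ℚ (ZMod 3) 2),
    W.IsTorsionGaloisRep 3 ρ → Function.Surjective ρ → ρ.IsModular

/-! ## §1 H0 — pointwise Langlands–Tunnell suffices (copy of the tree proof body) -/

/-- H0: the tree's `ModPGaloisRep.isModular_of_isAbsolutelyIrreducible_of_isOdd_of_langlands_tunnell`
uses `hLT` only at `σ = modThreeLift ρ`; the pointwise form lets each regime supply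
`langlands_tunnell (modThreeLift ρ)` by its own road. Size S (copy the body). -/
def SigPointwiseLT : Prop :=
  ∀ (ρ : ModPGaloisRep ℚ (ZMod 3) 2), FramedRep.IsAbsolutelyIrreducible ρ →
    FramedGaloisRep.IsOdd ρ → langlands_tunnell (modThreeLift ρ) → ρ.IsModular

/-! ## §2 H1 — the regime split of the surjective cell by a LOCAL PIN -/

/-- the finite place of `ℚ` at the prime `p`. -/
noncomputable def placeOf (p : ℕ) (hp : p.Prime) : HeightOneSpectrum (𝓞 ℚ) :=
  (Rat.HeightOneSpectrum.primesEquiv (R := 𝓞 ℚ)).symm ⟨p, hp⟩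

/-- residue characteristic of a finite place of `ℚ`. -/
noncomputable def residueChar (v : HeightOneSpectrum (𝓞 ℚ)) : ℕ :=
  ((Rat.HeightOneSpectrum.primesEquiv (R := 𝓞 ℚ) v : Nat.Primes) : ℕ)

/-- `v` does not split in `E = ℚ(√-3) = ℚ(ζ₃)` (the `A₄`-field of every `ρ̄_{E,3}`, since
`det ρ̄ = χ₃`): `p = 3` (ramified) or `p ≡ 2 (mod 3)` (inert). -/
def IsNonsplitInCycloThree (v : HeightOneSpectrum (𝓞 ℚ)) : Prop := residueChar v % 3 ≠ 1

/-- the decomposition group at `v` has NON-ABELIAN image under `ρ̄` (⟺ `Ψ ∘ ρ̄|G_v` is an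
irreducible complex representation, `Ψ : GL₂(𝔽₃) ↪ GL₂(ℤ[√-2])`). -/
def IsLocallyNonabelianAt (ρ : ModPGaloisRep ℚ (ZMod 3) 2) (v : HeightOneSpectrum (𝓞 ℚ)) : Prop :=
  ∃ g h : Field.absoluteGaloisGroup (v.adicCompletion ℚ),
    FramedGaloisRep.toLocal v ρ g * FramedGaloisRep.toLocal v ρ h ≠
      FramedGaloisRep.toLocal v ρ h * FramedGaloisRep.toLocal v ρ g

/-- Regime P ("locally pinned"): some place non-split in `ℚ(√-3)` has non-abelian local image. -/
def LocallyPinned (ρ : ModPGaloisRep ℚ (ZMod 3) 2) : Prop :=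
  ∃ v, IsNonsplitInCycloThree v ∧ IsLocallyNonabelianAt ρ v

/-- surjective cell, Regime P. -/
def SigSurjPinned : Prop :=
  ∀ (W : WeierstrassCurve ℚ) [W.IsElliptic] (ρ : ModPGaloisRep ℚ (ZMod 3) 2),
    W.IsTorsionGaloisRep 3 ρ → Function.Surjective ρ → LocallyPinned ρ → ρ.IsModular

/-- surjective cell, Regime U (no pin; = road R1 with Tunnell's cubic lift). -/
def SigSurjUnpinned : Prop :=
  ∀ (W : WeierstrassCurve ℚ) [W.IsElliptic] (ρ : ModPGaloisRep ℚ (ZMod 3) 2),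
    W.IsTorsionGaloisRep 3 ρ → Function.Surjective ρ → ¬ LocallyPinned ρ → ρ.IsModular

/-- H1 (proved): the dispatch of the surjective cell into the two regimes. -/
theorem surj_of_pinned_unpinned (hP : SigSurjPinned) (hU : SigSurjUnpinned) :
    SigStubModThreeSurj := by
  intro W _ ρ hρ hsurj
  by_cases h : LocallyPinned ρ
  · exact hP W ρ hρ hsurj h
  · exact hU W ρ hρ hsurj h

/-! ## §3 H2/H3 — Frey curves prime to 3 are supersingular at 3, hence pinned at 3 -/

/-- H2 (proved, kernel): for `3 ∤ a b (a+b)` the affine points of `y² = x(x-a)(x+b)` over `𝔽₃`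
are exactly the three points `y = 0` (the roots `0, a, -b` exhaust `𝔽₃`), so `#Ẽ(𝔽₃) = 4`,
`a₃ = 0`: the Frey curve is SUPERSINGULAR at `3`. -/
theorem frey_affine_points_mod_three :
    ∀ a b x y : ZMod 3, a ≠ 0 → b ≠ 0 → a + b ≠ 0 →
      (y ^ 2 = x * (x - a) * (x + b) ↔ y = 0) := by
  decide

/-- H2' (proved, kernel): the same count as a cardinality, `#Ẽ(𝔽₃)_aff = 3`. -/
theorem frey_card_affine_points_mod_three :
    ∀ a b : ZMod 3, a ≠ 0 → b ≠ 0 → a + b ≠ 0 →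
      (Finset.univ.filter (fun P : ZMod 3 × ZMod 3 => P.2 ^ 2 = P.1 * (P.1 - a) * (P.1 + b))).card
        = 3 := by
  decide

/-- H3 (M): a Frey curve with `3 ∤ a b (a + b)` is pinned at `3` — good supersingular reduction at
`p = 3` (H2), `e(ℚ₃) = 1`, so tame inertia acts on `E[3]` through the level-2 fundamental character
(cyclic of order 8) and a Frobenius acts on it by the cube map: the local image is the
normaliser of the non-split Cartan (`SD₁₆`), non-abelian (Serre 1972, §1.11 Prop. 12). -/
def SigFreySupersingularPinned : Prop :=
  ∀ (a b : ℤ), IsCoprime a b → a * b * (a + b) ≠ 0 → ¬ (3 : ℤ) ∣ a * b * (a + b) →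
    ∀ ρ : ModPGaloisRep ℚ (ZMod 3) 2, (freyCurve a b).IsTorsionGaloisRep 3 ρ →
      IsLocallyNonabelianAt ρ (placeOf 3 Nat.prime_three)

/-- H3 ⇒ Regime P for those Frey curves (proved: `3 % 3 ≠ 1`). -/
theorem locallyPinned_of_freySupersingular (h : SigFreySupersingularPinned) (a b : ℤ)
    (hab : IsCoprime a b) (h0 : a * b * (a + b) ≠ 0) (h3 : ¬ (3 : ℤ) ∣ a * b * (a + b))
    (ρ : ModPGaloisRep ℚ (ZMod 3) 2) (hρ : (freyCurve a b).IsTorsionGaloisRep 3 ρ) :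
    LocallyPinned ρ := by
  refine ⟨placeOf 3 Nat.prime_three, ?_, h a b hab h0 h3 ρ hρ⟩
  unfold IsNonsplitInCycloThree residueChar placeOf
  rw [Equiv.apply_symm_apply]
  decide

/-! ## §4 H4 — non-abelian local image ⟺ the complex lift is locally irreducible -/

/-- H4 (S/M): `ρ̄(G_v)` non-abelian ⟺ `(Ψ ∘ ρ̄)|G_v` irreducible over `ℂ` (a 2-dimensional complex
representation of a finite group is reducible iff its image is abelian; `Ψ` is injective). The
`⇐` half is the tree's `FramedRep.exists_mul_ne_mul_of_isAbsolutelyIrreducible` pattern. -/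
def SigNonabelianIffLocalLiftIrreducible : Prop :=
  ∀ (ρ : ModPGaloisRep ℚ (ZMod 3) 2) (v : HeightOneSpectrum (𝓞 ℚ)),
    IsLocallyNonabelianAt ρ v ↔ FramedRep.IsIrreducible (FramedGaloisRep.toLocal v (modThreeLift ρ))

/-! ## §5 P — the PIN fact (named-fact shape; Regime P replacement of `hb`+`hL`+`hW1`) -/

/-- P (L, named-fact shape, NOT in print as stated — see the md): **a pinned quadratic descent of
`π(σ_E)` is a weight-one newform.** `σ : Γ_ℚ → GL₂(ℂ)` irreducible odd; `E/ℚ` quadratic;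
`Π` cuspidal on `GL₂(𝔸_E)` with `Π = π(σ_E)` a.e.; `π` cuspidal on `GL₂(𝔸_ℚ)` lifting weakly to
`Π`; `v` a finite place with a UNIQUE place of `E` above it (non-split) at which `σ|G_v` is
irreducible. Then `π ↔` a weight-one newform (Satake = Hecke polynomial away from the level).
Route of proof: strong lifting at `v` (Arthur–Clozel III.5.1) + local base change on parameters
(Langlands 1980 §7, Clifford: the fibre over `π(σ_w)` is `{π(σ_v), π(σ_v) ⊗ η_v}` when `σ_v` is
irreducible) ⇒ `ω_{π,v} = det σ_v` ⇒ (`ω_π ∈ det σ · {1, ω_E}`, `ω_{E,v} ≠ 1`) `ω_π = det σ` odd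
⇒ (`Π_∞ = π(σ_{E,∞})` by Gelbart Prop. 4.1 over `E`, Arthur–Clozel archimedean lifting)
`π_∞ = π(1, sgn)` ⇒ weight one (Gelbart Prop. 2.5). Compare Gelbart 1977 §3.2 (the case `E`
real, where `∞` itself is the pin). -/
def exists_isNewform1_of_pinnedDescent : Prop :=
  ∀ (E : Type) [Field E] [NumberField E] [Algebra ℚ E], Module.finrank ℚ E = 2 →
    ∀ (hQ : isCompact_glFiniteIntegralLevel 2 ℚ) (hE : isCompact_glFiniteIntegralLevel 2 E)
      (σ : FramedArtinRep ℚ 2) (P : CuspidalAutomorphicRepData 2 E hE)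
      (π : CuspidalAutomorphicRepData 2 ℚ hQ) (v : HeightOneSpectrum (𝓞 ℚ)),
      FramedRep.IsIrreducible σ → σ.IsOdd →
      IsPiOfArtinRep (σ.restrictField E) P.1 → IsWeakBaseChangeLiftAE π.1 P.1 →
      (∀ w w' : HeightOneSpectrum (𝓞 E), w.asIdeal.under (𝓞 ℚ) = v.asIdeal →
          w'.asIdeal.under (𝓞 ℚ) = v.asIdeal → w = w') →
      FramedRep.IsIrreducible (FramedGaloisRep.toLocal v σ) →
        ∃ (N : ℕ) (_ : NeZero N) (f : CuspForm (CongruenceSubgroup.Gamma1 N) 1),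
          EllipticCurves.ModularForms.IsNewform1 f ∧
          ∀ w : HeightOneSpectrum (𝓞 ℚ),
            ¬ ((Rat.HeightOneSpectrum.primesEquiv w : Nat.Primes) : ℕ) ∣ N →
            ∃ α : Multiset ℂ, π.1.HasSatakeParamAt w α ∧
              satakePolynomial α =
                (EllipticCurves.ModularForms.heckePolynomial f
                    (Rat.HeightOneSpectrum.primesEquiv w : Nat.Primes)).map
                  (algebraMap (EllipticCurves.ModularForms.coeffCharField f) ℂ)

end Summit.ABC.ABC.Cruxes.FreyModularity.StubModThreeIdeasK2G16
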